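import Mathlib
import Summits.Ventures.PercRepro2.TBAdm

/-!
# `TBFavX` is a case of the admissibility rule — the chain `TBAdm → TBFavX → TBFav → TB14`
(blind cell PercRepro2, mine-c g20, 2026-08-25; `conjectures/MINE-C.md` §29.8)

A two-colour avoid set `X` at one root is the admissible system in which every vertex of `X` carries
the avoidance constraint of that root's kind and the favourable constraints of `S` stay as they are
(merged with the avoidance on `S ∩ X`); the global rule of `AdmSystem` holds because only ONE
avoidance kind occurs and the other root's exclusion appears nowhere.  The kernels agree pointwise
(`admK_avoidSys₂` / `admK_avoidSys₁`, using that an indicator is idempotent), so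
`TBFavX_of_TBAdm : TBAdm R → TBFavX R` — the lemma announced in `TBAdm.lean`'s docstring as
`favKX_disjoint_of_TBAdm`, here without any disjointness hypothesis.  Own work; standard axioms.
-/

namespace Summit.Ventures.PercRepro2

namespace FavCond

open CovForm A3InactiveTyped TB14Cut

section MergedConstraints

variable {V : Type*} {E : Type*} {R : Type*} [Field R]

/-- A favourable constraint merged with the two-colour `a₂`-avoidance (`∉ M_r`, `∉ M_b`). -/
def AdmCon.withAvoid₂ (c : FavCon) : AdmCon := ⟨c.inKb, c.inMr, c.notKr, true, false, true⟩

/-- A favourable constraint merged with the two-colour `a₁`-avoidance (`∉ K_r`, `∉ K_b`). -/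
def AdmCon.withAvoid₁ (c : FavCon) : AdmCon := ⟨c.inKb, c.inMr, true, c.notMb, true, false⟩

/-- An indicator is idempotent: `(1 − 1_A)² = 1 − 1_A`. -/
lemma one_sub_iH_sq (ends : E → Sym2 V) (a v : V) (ω : Config E) :
    ((1 - iH ends a v ω) * (1 - iH ends a v ω) : R) = 1 - iH ends a v ω := by
  classical
  rw [iH_eq_ite']
  split_ifs <;> ring

/-- An idempotent factor may be duplicated: `A · W · Y = A · W · (Y · W)` when `W² = W`. -/
lemma mul_idem_aux (A W Y : R) (h : W * W = W) : A * W * Y = A * W * (Y * W) := by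
  linear_combination (-(A * Y)) * h

/-- The merged `a₂`-constraint is the favourable indicator times the avoidance factor. -/
lemma admInd_withAvoid₂ (ends : E → Sym2 V) (a₁ a₂ : V) (c : FavCon) (v : V) (y w : Config E) :
    (admInd ends a₁ a₂ (AdmCon.withAvoid₂ c) v y w : R) =
      favInd ends a₁ a₂ c v y w * ((1 - iH ends a₂ v y) * (1 - iH ends a₂ v w)) := by
  simp only [admInd, favInd, AdmCon.withAvoid₂, Bool.false_eq_true, ↓reduceIte, mul_one]
  by_cases h : c.notMb
  · simp only [h, ↓reduceIte]
    exact mul_idem_aux _ _ _ (one_sub_iH_sq (R := R) ends a₂ v w)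
  · simp only [h, Bool.false_eq_true, ↓reduceIte, mul_one]
    ring

/-- The merged `a₁`-constraint is the favourable indicator times the avoidance factor
(`iL` and `iH` are the same indicator). -/
lemma admInd_withAvoid₁ (ends : E → Sym2 V) (a₁ a₂ : V) (c : FavCon) (v : V) (y w : Config E) :
    (admInd ends a₁ a₂ (AdmCon.withAvoid₁ c) v y w : R) =
      favInd ends a₁ a₂ c v y w * ((1 - iH ends a₁ v y) * (1 - iH ends a₁ v w)) := by
  simp only [admInd, favInd, AdmCon.withAvoid₁, Bool.false_eq_true, ↓reduceIte, mul_one, iL, iH]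
  by_cases h : c.notKr
  · simp only [h, ↓reduceIte]
    have hsq := one_sub_iH_sq (R := R) ends a₁ v y
    simp only [iH] at hsq
    -- `A * (1 - Y) * (1 - W) = A * (1 - Y) * ((1 - Y) * (1 - W))`
    linear_combination (-((if c.inKb = true then (connEvent ends a₁ v).indicator 1 w else 1) *
      (if c.inMr = true then (connEvent ends a₂ v).indicator 1 y else 1) *
      (if c.notMb = true then 1 - (connEvent ends a₂ v).indicator 1 w else 1) *
      (1 - (connEvent ends a₁ v).indicator 1 w))) * hsq
  · simp only [h, Bool.false_eq_true, ↓reduceIte, mul_one]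
    ring

/-- The merged `a₂`-constraint is valid. -/
lemma AdmCon.valid_withAvoid₂ (c : FavCon) : (AdmCon.withAvoid₂ c).Valid :=
  ⟨fun h => by simp [AdmCon.UnaccKb, AdmCon.withAvoid₂] at h, fun _ => rfl,
    fun h => by simp [AdmCon.UnaccKb, AdmCon.withAvoid₂] at h⟩

/-- The merged `a₁`-constraint is valid. -/
lemma AdmCon.valid_withAvoid₁ (c : FavCon) : (AdmCon.withAvoid₁ c).Valid :=
  ⟨fun _ => rfl, fun h => by simp [AdmCon.UnaccMr, AdmCon.withAvoid₁] at h,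
    fun h => by simp [AdmCon.UnaccMr, AdmCon.withAvoid₁] at h⟩

end MergedConstraints

section AvoidSystems

variable {V : Type*} [DecidableEq V]

/-- The constraint system of `favKX` with an `a₂`-avoid set `X`: favourable on `S`, merged on
`S ∩ X`, pure avoidance on `X ∖ S`. -/
def avoidSys₂ (S X : Finset V) (c : V → FavCon) : V → AdmCon := fun v =>
  if v ∈ S then (if v ∈ X then AdmCon.withAvoid₂ (c v) else AdmCon.ofFav (c v)) else AdmCon.avoid₂

/-- The mirror system with an `a₁`-avoid set. -/
def avoidSys₁ (S X : Finset V) (c : V → FavCon) : V → AdmCon := fun v =>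
  if v ∈ S then (if v ∈ X then AdmCon.withAvoid₁ (c v) else AdmCon.ofFav (c v)) else AdmCon.avoid₁

/-- No constraint of `avoidSys₂` carries an `a₁`-avoidance. -/
lemma notKb_avoidSys₂ (S X : Finset V) (c : V → FavCon) (v : V) :
    (avoidSys₂ S X c v).notKb = false := by
  unfold avoidSys₂
  split_ifs <;> rfl

/-- No constraint of `avoidSys₁` carries an `a₂`-avoidance. -/
lemma notMr_avoidSys₁ (S X : Finset V) (c : V → FavCon) (v : V) :
    (avoidSys₁ S X c v).notMr = false := by
  unfold avoidSys₁
  split_ifs <;> rfl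

/-- **`avoidSys₂` is admissible** (only the `a₂`-avoidance kind occurs, `∉ K_b` nowhere). -/
lemma admSystem_avoidSys₂ (S X : Finset V) (c : V → FavCon) :
    AdmSystem (S ∪ X) (avoidSys₂ S X c) := by
  refine ⟨fun v _ => ?_, fun ⟨v, _, hv⟩ => ?_, fun _ u _ => notKb_avoidSys₂ S X c u⟩
  · unfold avoidSys₂
    split_ifs
    · exact AdmCon.valid_withAvoid₂ _
    · exact AdmCon.valid_ofFav _
    · exact AdmCon.valid_avoid₂
  · exact absurd hv.1 (by rw [notKb_avoidSys₂]; decide)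

/-- **`avoidSys₁` is admissible** (only the `a₁`-avoidance kind occurs, `∉ M_r` nowhere). -/
lemma admSystem_avoidSys₁ (S X : Finset V) (c : V → FavCon) :
    AdmSystem (S ∪ X) (avoidSys₁ S X c) := by
  refine ⟨fun v _ => ?_, fun _ u _ => notMr_avoidSys₁ S X c u, fun ⟨v, _, hv⟩ => ?_⟩
  · unfold avoidSys₁
    split_ifs
    · exact AdmCon.valid_withAvoid₁ _
    · exact AdmCon.valid_ofFav _
    · exact AdmCon.valid_avoid₁
  · exact absurd hv.1 (by rw [notMr_avoidSys₁]; decide)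

end AvoidSystems

section KernelIdentity

variable {V : Type*} {E : Type*} {R : Type*} [Field R] [DecidableEq V]

/-- The admissible kernel of `avoidSys₂` is `favKX` with the `a₂`-avoid set `X` (and `X₁ = ∅`). -/
lemma admK_avoidSys₂ (ends : E → Sym2 V) (a₁ a₂ o : V) (S X : Finset V) (c : V → FavCon)
    (y w : Config E) :
    (admK ends a₁ a₂ o (S ∪ X) (avoidSys₂ S X c) y w : R) = favKX ends a₁ a₂ o ∅ X S c y w := by
  have hprod : (∏ v ∈ S ∪ X, admInd ends a₁ a₂ (avoidSys₂ S X c v) v y w : R) =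
      (∏ v ∈ S, favInd ends a₁ a₂ (c v) v y w) *
        ∏ x ∈ X, ((1 - iH ends a₂ x y) * (1 - iH ends a₂ x w)) := by
    rw [← Finset.union_sdiff_self_eq_union, Finset.prod_union Finset.disjoint_sdiff]
    have h1 : (∏ v ∈ S, admInd ends a₁ a₂ (avoidSys₂ S X c v) v y w : R) =
        (∏ v ∈ S, favInd ends a₁ a₂ (c v) v y w) *
          ∏ v ∈ S, (if v ∈ X then ((1 - iH ends a₂ v y) * (1 - iH ends a₂ v w)) else 1) := by
      rw [← Finset.prod_mul_distrib]
      refine Finset.prod_congr rfl fun v hv => ?_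
      simp only [avoidSys₂, if_pos hv]
      by_cases hx : v ∈ X
      · rw [if_pos hx, if_pos hx, admInd_withAvoid₂]
      · rw [if_neg hx, if_neg hx, admInd_ofFav, mul_one]
    have h2 : (∏ v ∈ X \ S, admInd ends a₁ a₂ (avoidSys₂ S X c v) v y w : R) =
        ∏ v ∈ X \ S, ((1 - iH ends a₂ v y) * (1 - iH ends a₂ v w)) := by
      refine Finset.prod_congr rfl fun v hv => ?_
      have hvS : v ∉ S := (Finset.mem_sdiff.1 hv).2
      simp only [avoidSys₂, if_neg hvS]
      exact admInd_avoid₂ ends a₁ a₂ v y w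
    rw [h1, h2, Finset.prod_ite_mem, mul_assoc]
    congr 1
    rw [Finset.inter_comm, ← Finset.prod_union (Finset.disjoint_sdiff_inter X S).symm,
      Finset.union_comm, Finset.sdiff_union_inter]
  simp only [admK, favKX, favK, avoidInd, Finset.prod_empty, hprod]
  ring

/-- The mirror: the admissible kernel of `avoidSys₁` is `favKX` with the `a₁`-avoid set `X`. -/
lemma admK_avoidSys₁ (ends : E → Sym2 V) (a₁ a₂ o : V) (S X : Finset V) (c : V → FavCon)
    (y w : Config E) :
    (admK ends a₁ a₂ o (S ∪ X) (avoidSys₁ S X c) y w : R) = favKX ends a₁ a₂ o X ∅ S c y w := by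
  have hprod : (∏ v ∈ S ∪ X, admInd ends a₁ a₂ (avoidSys₁ S X c v) v y w : R) =
      (∏ v ∈ S, favInd ends a₁ a₂ (c v) v y w) *
        ∏ x ∈ X, ((1 - iH ends a₁ x y) * (1 - iH ends a₁ x w)) := by
    rw [← Finset.union_sdiff_self_eq_union, Finset.prod_union Finset.disjoint_sdiff]
    have h1 : (∏ v ∈ S, admInd ends a₁ a₂ (avoidSys₁ S X c v) v y w : R) =
        (∏ v ∈ S, favInd ends a₁ a₂ (c v) v y w) *
          ∏ v ∈ S, (if v ∈ X then ((1 - iH ends a₁ v y) * (1 - iH ends a₁ v w)) else 1) := by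
      rw [← Finset.prod_mul_distrib]
      refine Finset.prod_congr rfl fun v hv => ?_
      simp only [avoidSys₁, if_pos hv]
      by_cases hx : v ∈ X
      · rw [if_pos hx, if_pos hx, admInd_withAvoid₁]
      · rw [if_neg hx, if_neg hx, admInd_ofFav, mul_one]
    have h2 : (∏ v ∈ X \ S, admInd ends a₁ a₂ (avoidSys₁ S X c v) v y w : R) =
        ∏ v ∈ X \ S, ((1 - iH ends a₁ v y) * (1 - iH ends a₁ v w)) := by
      refine Finset.prod_congr rfl fun v hv => ?_
      have hvS : v ∉ S := (Finset.mem_sdiff.1 hv).2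
      simp only [avoidSys₁, if_neg hvS]
      exact admInd_avoid₁ ends a₁ a₂ v y w
    rw [h1, h2, Finset.prod_ite_mem, mul_assoc]
    congr 1
    rw [Finset.inter_comm, ← Finset.prod_union (Finset.disjoint_sdiff_inter X S).symm,
      Finset.union_comm, Finset.sdiff_union_inter]
  simp only [admK, favKX, favK, avoidInd, Finset.prod_empty, hprod]
  ring

end KernelIdentity

section ReductionAdmX

variable {R : Type*} [Field R] [LinearOrder R]

/-- **`TBFavX` is a case of `TBAdm`**: a one-root avoid set is an admissible system of
avoidance-type constraints of one kind (the chain `TBAdm → TBFavX → TBFav → TB14`). -/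
theorem TBFavX_of_TBAdm (h : TBAdm R) : TBFavX R := by
  intro V E _ _ _ _ ends a₁ a₂ o X₁ X₂ S c F z hX
  rcases hX with hX₁ | hX₂
  · subst hX₁
    have h1 := h V E ends a₁ a₂ o (S ∪ X₂) (avoidSys₂ S X₂ c) F z (admSystem_avoidSys₂ S X₂ c)
    have : pairCount F z (admK ends a₁ a₂ o (S ∪ X₂) (avoidSys₂ S X₂ c) :
        Config E → Config E → R) = pairCount F z (favKX ends a₁ a₂ o ∅ X₂ S c) := by
      congr 1
      funext y w
      exact admK_avoidSys₂ ends a₁ a₂ o S X₂ c y w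
    rw [this] at h1
    exact h1
  · subst hX₂
    have h1 := h V E ends a₁ a₂ o (S ∪ X₁) (avoidSys₁ S X₁ c) F z (admSystem_avoidSys₁ S X₁ c)
    have : pairCount F z (admK ends a₁ a₂ o (S ∪ X₁) (avoidSys₁ S X₁ c) :
        Config E → Config E → R) = pairCount F z (favKX ends a₁ a₂ o X₁ ∅ S c) := by
      congr 1
      funext y w
      exact admK_avoidSys₁ ends a₁ a₂ o S X₁ c y w
    rw [this] at h1
    exact h1

end ReductionAdmX

end FavCond

end Summit.Ventures.PercRepro2
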